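import Literature.InformationTheory.Entanglement.GHZFidelityWitness
import HarnessLib

/-!
# The Gühne–Seevinck criterion: `|ρ_{0…0,1…1}| ≤ ½ Σ_{0<|I|<N} √(ρ_I ρ_Ī)` on biseparable states

Topic `Literature/InformationTheory/Entanglement`, companion of `GHZFidelityWitness.lean` (same
register `Fin N → Bool`, same `IsBiseparablePure` / `IsBiseparable`, same `coherence`
`C = |ρ_{0…0,1…1}| + |ρ_{1…1,0…0}|`).  Source (held text, read at the cited places):

* O. Gühne, M. Seevinck, *Separability criteria for genuine multiparticle entanglement*,
  New J. Phys. 12, 053002 (2010) = arXiv:0905.1349 [GuhneSeevinck2010]: §1 (“A pure state is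
  called biseparable if it is separable under some bipartition … A mixed state is biseparable if
  it can be written as `ρ^bs = Σ_k p_k |ψ_k^bs⟩⟨ψ_k^bs|` where the `|ψ_k^bs⟩` might be biseparable
  under different partitions”); §2 **Observation 1** “Let `ρ` be a biseparable three-qubit state.
  Then its matrix entries fulfill `|ρ_{1,8}| ≤ √(ρ_{2,2}ρ_{7,7}) + √(ρ_{3,3}ρ_{6,6}) + √(ρ_{4,4}ρ_{5,5})`
  and violation implies genuine three-qubit entanglement” with its printed proof (“the function
  `h = √(fg)` is concave … the absolute value is convex … So it suffices to prove its positivity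
  for pure biseparable states … `|ψ⟩ = (a₀|0⟩ + a₁|1⟩) ⊗ (b₀₀|00⟩ + … + b₁₁|11⟩)` … one can
  directly see that `|ρ_{1,8}| = √(ρ_{4,4}ρ_{5,5})`”), “Note that Eq. (1) is independent of the
  normalization of the state”, “Eq. (1) is maximally violated by the GHZ state”; §3 (notation
  `ρ_I`, `Ī` “arising from `I` if zeroes and ones are exchanged”, `|I|` the number of ones) and
  the `N`-qubit statement “for `N`-qubit GHZ states, the criterion reads
  **`𝒪^{|GHZ_N⟩}(ρ) ≤ ½ Σ_{|I|=1}^{N−1} √(ρ_I ρ_Ī)`**” (with `𝒪^{|GHZ_N⟩}(ρ) = |ρ_{1,2^N}|`, “The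
  factor `1/2` takes into account that each possible term occurs twice in the sum”).
* T. Monz et al., PRL 106, 130506 (2011) [MonzEtAl2011], p. 3: the 14-qubit GHZ analysis uses
  exactly this criterion (“a more stringent criterion proves genuine `N`-particle entanglement
  [Gühne–Seevinck] … the obtained data support genuine `N`-particle entanglement for 14 qubits”).

HONEST FRAMING (pub-qadeq lane — GHZ-state milestones whose fidelity is BELOW `1/2` but which
claim genuine `N`-partite entanglement via this criterion): instance-level adjudication of
specific advantage claims; no claim about BQP vs BPP or the summit.  This file proves the
criterion; the statistics of estimated matrix elements are not addressed.

## Contents (all proved, 0 named facts)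

* `flip` (`Ī`), `innerLabels N` (the `I` with `0 < |I| < N`, i.e. `I ∉ {0…0, 1…1}`),
  `ghzOffDiag ρ = |ρ_{0…0,1…1}|`, `diagPair ρ I = √(ρ_I ρ_Ī)`, `gsSum ρ = Σ_{0<|I|<N} √(ρ_I ρ_Ī)`.
* **`two_mul_ghzOffDiag_le_gsSum_of_isBiseparablePure`** — the pure-state step of the printed
  proof: for `ψ = a ⊗_A b`, `|ρ_{0…0,1…1}| = √(ρ_{I₀} ρ_{Ī₀})` for the label `I₀ = (0 on A, 1 on Ā)`,
  so `2|ρ_{0…0,1…1}| ≤ Σ_{0<|I|<N} √(ρ_I ρ_Ī)` (no normalisation needed).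
* `sum_mul_sqrt_mul_le` — concavity of `√(fg)` along mixtures (Cauchy–Schwarz).
* **`guhneSeevinck_ghz`** — for every biseparable `ρ`: `|ρ_{0…0,1…1}| ≤ ½ Σ_{0<|I|<N} √(ρ_I ρ_Ī)`;
  **`coherence_le_gsSum`** (the same with the lane's `C = |ρ_{0…0,1…1}| + |ρ_{1…1,0…0}|`:
  `C ≤ Σ_{0<|I|<N} √(ρ_I ρ_Ī)`); **`not_isBiseparable_of_gsSum_lt`** /
  **`not_isBiseparable_of_gsSum_lt_coherence`** (violation ⟹ genuine `N`-partite entanglement).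
* Coarse-graining for collective readout (proved here, by Cauchy–Schwarz): `sum_diagPair_le`
  (`Σ_{I∈S} √(ρ_I ρ_Ī) ≤ √((Σ_S ρ_I)(Σ_S ρ_Ī))`) and **`coherence_le_sum_fiber_sqrt`** (group the
  inner labels by any statistic, e.g. the excitation number: `C ≤ Σ_k √(P_k P_{N−k})`).
* `ghzOffDiag_ghzN` (`= 1/2`), `gsSum_ghzN` (`= 0`): “maximally violated by the GHZ state”.

NOT formalised: Observation 2 (necessity and sufficiency for GHZ-diagonal states), Observations
3–5 (W and Dicke criteria), full separability (Observation 4).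

## Mathlib / tree search

Nothing of this kind in Mathlib or the tree (`lean search 'Seevinck|ghzOffDiag|biseparab'`: only
`GHZFidelityWitness.lean` / `WStateWitness.lean`).  Reused: `IsBiseparable`, `tensorAcross`,
`restrictIn/Out`, `constLabel`, `coherence`, `ghzN`, `ket` (`GHZFidelityWitness.lean`); Mathlib's
`Finset.sum_mul_sq_le_sq_mul_sq` (Cauchy–Schwarz).
-/

namespace Literature.InformationTheory.Entanglement

namespace GuhneSeevinck

open Matrix Complex Finset
open Literature.InformationTheory.Entanglement.Tsirelson
open GHZWitness

variable {N : ℕ}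

/-! ## Labels: `Ī` and the inner labels `0 < |I| < N` -/

/-- `Ī`: “the tuple arising from `I` if zeroes and ones are exchanged”.
[cite: GuhneSeevinck2010, §3] -/
def flip (x : Fin N → Bool) : Fin N → Bool := fun i => !x i

/-- Unfolding `flip`. [cite: GuhneSeevinck2010, §3] -/
@[simp] theorem flip_apply (x : Fin N → Bool) (i : Fin N) : flip x i = !x i := rfl

/-- `Ī̄ = I`. [cite: GuhneSeevinck2010, §3] -/
@[simp] theorem flip_flip (x : Fin N → Bool) : flip (flip x) = x := by
  funext i
  simp

/-- `0…0̄ = 1…1` and `1…1̄ = 0…0`. [cite: GuhneSeevinck2010, §3] -/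
@[simp] theorem flip_constLabel (b : Bool) : flip (constLabel N b) = constLabel N (!b) := rfl

/-- The labels `I` with `0 < |I| < N`, i.e. all basis labels except `0…0` and `1…1` (the index
range `Σ_{|I|=1}^{N−1}` of the criterion). [cite: GuhneSeevinck2010, §3] -/
def innerLabels (N : ℕ) : Finset (Fin N → Bool) :=
  Finset.univ.filter fun x => x ≠ constLabel N false ∧ x ≠ constLabel N true

/-- Membership in `innerLabels`. [cite: GuhneSeevinck2010, §3] -/
theorem mem_innerLabels {x : Fin N → Bool} :
    x ∈ innerLabels N ↔ x ≠ constLabel N false ∧ x ≠ constLabel N true := by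
  simp [innerLabels]

/-- `0 < |I| < N ⟹ 0 < |Ī| < N`. [cite: GuhneSeevinck2010, §3] -/
theorem flip_mem_innerLabels {x : Fin N → Bool} (hx : x ∈ innerLabels N) :
    flip x ∈ innerLabels N := by
  rw [mem_innerLabels] at hx ⊢
  refine ⟨fun h => hx.2 ?_, fun h => hx.1 ?_⟩
  · rw [← flip_flip x, h]; rfl
  · rw [← flip_flip x, h]; rfl

/-! ## The two sides of the criterion -/

/-- `𝒪^{|GHZ_N⟩}(ρ) = |ρ_{0…0,1…1}|` (`= |ρ_{1,2^N}|`, for three qubits `|ρ_{1,8}|`).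
[cite: GuhneSeevinck2010, §2 Observation 1 and §3] -/
noncomputable def ghzOffDiag (ρ : Matrix (Fin N → Bool) (Fin N → Bool) ℂ) : ℝ :=
  ‖ρ (constLabel N false) (constLabel N true)‖

/-- The term `√(ρ_I ρ_Ī)` (real parts of the diagonal entries). [cite: GuhneSeevinck2010, §2
Observation 1 and §3] -/
noncomputable def diagPair (ρ : Matrix (Fin N → Bool) (Fin N → Bool) ℂ) (x : Fin N → Bool) : ℝ :=
  Real.sqrt ((ρ x x).re * (ρ (flip x) (flip x)).re)

/-- `√(ρ_Ī ρ_I) = √(ρ_I ρ_Ī)` (“each possible term occurs twice in the sum”).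
[cite: GuhneSeevinck2010, §3 (proof of Observation 5)] -/
theorem diagPair_flip (ρ : Matrix (Fin N → Bool) (Fin N → Bool) ℂ) (x : Fin N → Bool) :
    diagPair ρ (flip x) = diagPair ρ x := by
  rw [diagPair, diagPair, flip_flip, mul_comm]

/-- `√(ρ_I ρ_Ī) ≥ 0`. [cite: GuhneSeevinck2010, §2 Observation 1] -/
theorem diagPair_nonneg (ρ : Matrix (Fin N → Bool) (Fin N → Bool) ℂ) (x : Fin N → Bool) :
    0 ≤ diagPair ρ x := Real.sqrt_nonneg _

/-- The right-hand side `Σ_{|I|=1}^{N−1} √(ρ_I ρ_Ī) = Σ_{0<|I|<N} √(ρ_I ρ_Ī)` (for `N = 3`: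
`2(√(ρ₂₂ρ₇₇) + √(ρ₃₃ρ₆₆) + √(ρ₄₄ρ₅₅))`, each pair counted twice). [cite: GuhneSeevinck2010, §3
and §2 Observation 1] -/
noncomputable def gsSum (ρ : Matrix (Fin N → Bool) (Fin N → Bool) ℂ) : ℝ :=
  ∑ x ∈ innerLabels N, diagPair ρ x

/-- `Σ_{0<|I|<N} √(ρ_I ρ_Ī) ≥ 0`. [cite: GuhneSeevinck2010, §2 Observation 1] -/
theorem gsSum_nonneg (ρ : Matrix (Fin N → Bool) (Fin N → Bool) ℂ) : 0 ≤ gsSum ρ :=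
  Finset.sum_nonneg fun x _ => diagPair_nonneg ρ x

/-! ## Pure product states across a cut: `|ρ_{0…0,1…1}| = √(ρ_{I₀} ρ_{Ī₀})` -/

section Cut

variable (A : Finset (Fin N))

/-- The label `I₀ = (0 on A, 1 on Ā)` (for the cut `A|BC` of three qubits: `I₀ = 011`, the
`ρ_{4,4}ρ_{5,5}` of the printed proof). [cite: GuhneSeevinck2010, §2 (proof of Observation 1)] -/
def cutLabel : Fin N → Bool := fun i => decide (i ∉ A)

/-- `I₀|_A = 0…0`. [cite: GuhneSeevinck2010, §2 (proof of Observation 1)] -/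
theorem restrictIn_cutLabel : restrictIn A (cutLabel A) = fun _ => false := by
  funext u
  simp [restrictIn, cutLabel, u.2]

/-- `I₀|_Ā = 1…1`. [cite: GuhneSeevinck2010, §2 (proof of Observation 1)] -/
theorem restrictOut_cutLabel : restrictOut A (cutLabel A) = fun _ => true := by
  funext v
  simp [restrictOut, cutLabel, v.2]

/-- `Ī₀|_A = 1…1`. [cite: GuhneSeevinck2010, §2 (proof of Observation 1)] -/
theorem restrictIn_flip_cutLabel : restrictIn A (flip (cutLabel A)) = fun _ => true := by
  funext u
  simp [restrictIn, cutLabel, u.2]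

/-- `Ī₀|_Ā = 0…0`. [cite: GuhneSeevinck2010, §2 (proof of Observation 1)] -/
theorem restrictOut_flip_cutLabel : restrictOut A (flip (cutLabel A)) = fun _ => false := by
  funext v
  simp [restrictOut, cutLabel, v.2]

variable {A}

/-- `0 < |I₀| < N` when both sides of the cut are non-empty. [cite: GuhneSeevinck2010, §2 (proof
of Observation 1)] -/
theorem cutLabel_mem_innerLabels (hA : A.Nonempty) (hAc : Aᶜ.Nonempty) :
    cutLabel A ∈ innerLabels N := by
  rw [mem_innerLabels]
  obtain ⟨i, hi⟩ := hA
  obtain ⟨j, hj⟩ := hAc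
  rw [Finset.mem_compl] at hj
  refine ⟨fun h => ?_, fun h => ?_⟩
  · have := congrFun h j
    simp [cutLabel, hj] at this
  · have := congrFun h i
    simp [cutLabel, hi] at this

/-- `Ī₀ ≠ I₀` (`A` non-empty). [cite: GuhneSeevinck2010, §2 (proof of Observation 1)] -/
theorem cutLabel_ne_flip (hA : A.Nonempty) : cutLabel A ≠ flip (cutLabel A) := by
  obtain ⟨i, hi⟩ := hA
  intro h
  have := congrFun h i
  simp [cutLabel, hi] at this

end Cut

/-- Diagonal entries of `|ψ⟩⟨ψ|`: `ρ_I = |ψ(I)|²`. [cite: GuhneSeevinck2010, §2 (proof of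
Observation 1)] -/
private theorem pure_diag_re (ψ : (Fin N → Bool) → ℂ) (x : Fin N → Bool) :
    ((vecMulVec ψ (star ψ)) x x).re = Complex.normSq (ψ x) := by
  rw [vecMulVec_apply, Pi.star_apply, Complex.star_def, Complex.mul_conj, Complex.ofReal_re]

/-- For `|ψ⟩⟨ψ|`: `√(ρ_I ρ_Ī) = |ψ(I)|·|ψ(Ī)|`. [cite: GuhneSeevinck2010, §2 (proof of
Observation 1)] -/
theorem diagPair_pure (ψ : (Fin N → Bool) → ℂ) (x : Fin N → Bool) :
    diagPair (vecMulVec ψ (star ψ)) x = ‖ψ x‖ * ‖ψ (flip x)‖ := by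
  rw [diagPair, pure_diag_re, pure_diag_re, Complex.normSq_eq_norm_sq, Complex.normSq_eq_norm_sq,
    ← mul_pow, Real.sqrt_sq (mul_nonneg (norm_nonneg _) (norm_nonneg _))]

/-- For `|ψ⟩⟨ψ|`: `|ρ_{0…0,1…1}| = |ψ(0…0)|·|ψ(1…1)|`. [cite: GuhneSeevinck2010, §2 (proof of
Observation 1)] -/
theorem ghzOffDiag_pure (ψ : (Fin N → Bool) → ℂ) :
    ghzOffDiag (vecMulVec ψ (star ψ)) = ‖ψ (constLabel N false)‖ * ‖ψ (constLabel N true)‖ := by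
  rw [ghzOffDiag, vecMulVec_apply, Pi.star_apply, norm_mul, norm_star]

/-- **The pure-state step** (“one can directly see that `|ρ_{1,8}| = √(ρ_{4,4}ρ_{5,5})`”): for a
product `ψ = a ⊗_A b`, `|ρ_{0…0,1…1}| = |a(0)b(0)a(1)b(1)| = √(ρ_{I₀} ρ_{Ī₀})`.
[cite: GuhneSeevinck2010, §2 (proof of Observation 1)] -/
theorem diagPair_cutLabel_eq_ghzOffDiag (A : Finset (Fin N)) (a : ({i // i ∈ A} → Bool) → ℂ)
    (b : ({i // i ∉ A} → Bool) → ℂ) :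
    diagPair (vecMulVec (tensorAcross A a b) (star (tensorAcross A a b))) (cutLabel A) =
      ghzOffDiag (vecMulVec (tensorAcross A a b) (star (tensorAcross A a b))) := by
  rw [diagPair_pure, ghzOffDiag_pure]
  simp only [tensorAcross_apply, restrictIn_cutLabel, restrictOut_cutLabel,
    restrictIn_flip_cutLabel, restrictOut_flip_cutLabel, restrictIn_constLabel,
    restrictOut_constLabel, norm_mul]
  ring

/-- **Observation 1 / the `N`-qubit GHZ criterion for pure biseparable states** (no
normalisation needed): `2|ρ_{0…0,1…1}| ≤ Σ_{0<|I|<N} √(ρ_I ρ_Ī)` — the two terms `I₀`, `Ī₀` of the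
sum already give `2|ρ_{0…0,1…1}|`. [cite: GuhneSeevinck2010, §2 Observation 1 (proof) and §3] -/
theorem two_mul_ghzOffDiag_le_gsSum_of_isBiseparablePure {ψ : (Fin N → Bool) → ℂ}
    (hψ : IsBiseparablePure ψ) :
    2 * ghzOffDiag (vecMulVec ψ (star ψ)) ≤ gsSum (vecMulVec ψ (star ψ)) := by
  obtain ⟨A, hA, hAc, a, b, rfl⟩ := hψ
  set ρ := vecMulVec (tensorAcross A a b) (star (tensorAcross A a b))
  have hx₀ : cutLabel A ∈ innerLabels N := cutLabel_mem_innerLabels hA hAc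
  have hx₁ : flip (cutLabel A) ∈ innerLabels N := flip_mem_innerLabels hx₀
  have hne : cutLabel A ≠ flip (cutLabel A) := cutLabel_ne_flip hA
  have hval : diagPair ρ (cutLabel A) = ghzOffDiag ρ := diagPair_cutLabel_eq_ghzOffDiag A a b
  have hsub : ({cutLabel A, flip (cutLabel A)} : Finset (Fin N → Bool)) ⊆ innerLabels N := by
    intro x hx
    rw [Finset.mem_insert, Finset.mem_singleton] at hx
    rcases hx with rfl | rfl
    exacts [hx₀, hx₁]
  calc 2 * ghzOffDiag ρ = diagPair ρ (cutLabel A) + diagPair ρ (flip (cutLabel A)) := by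
        rw [diagPair_flip, hval]; ring
    _ = ∑ x ∈ ({cutLabel A, flip (cutLabel A)} : Finset (Fin N → Bool)), diagPair ρ x := by
        rw [Finset.sum_pair hne]
    _ ≤ gsSum ρ :=
        Finset.sum_le_sum_of_subset_of_nonneg hsub fun x _ _ => diagPair_nonneg ρ x

/-! ## Mixtures: `|·|` is convex, `√(fg)` is concave -/

/-- Concavity of `√(fg)` along a mixture, in Cauchy–Schwarz form:
`Σ_i p_i √(α_i β_i) ≤ √((Σ_i p_i α_i)(Σ_i p_i β_i))` for `p, α, β ≥ 0` (“for two positive linear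
functions `f(x)` and `g(x)` the function `h = √(fg)` is concave”). [cite: GuhneSeevinck2010, §2
(proof of Observation 1)] -/
theorem sum_mul_sqrt_mul_le {ι : Type*} [Fintype ι] (p α β : ι → ℝ) (hp : ∀ i, 0 ≤ p i)
    (hα : ∀ i, 0 ≤ α i) (hβ : ∀ i, 0 ≤ β i) :
    ∑ i, p i * Real.sqrt (α i * β i) ≤ Real.sqrt ((∑ i, p i * α i) * (∑ i, p i * β i)) := by
  have key : ∀ i, p i * Real.sqrt (α i * β i) =
      Real.sqrt (p i * α i) * Real.sqrt (p i * β i) := by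
    intro i
    rw [← Real.sqrt_mul (mul_nonneg (hp i) (hα i)),
      show p i * α i * (p i * β i) = (p i) ^ 2 * (α i * β i) by ring,
      Real.sqrt_mul (sq_nonneg _), Real.sqrt_sq (hp i)]
  have hL : 0 ≤ ∑ i, p i * Real.sqrt (α i * β i) :=
    Finset.sum_nonneg fun i _ => mul_nonneg (hp i) (Real.sqrt_nonneg _)
  rw [← Real.sqrt_sq hL]
  apply Real.sqrt_le_sqrt
  simp_rw [key]
  calc (∑ i, Real.sqrt (p i * α i) * Real.sqrt (p i * β i)) ^ 2
      ≤ (∑ i, Real.sqrt (p i * α i) ^ 2) * (∑ i, Real.sqrt (p i * β i) ^ 2) :=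
        Finset.sum_mul_sq_le_sq_mul_sq _ _ _
    _ = (∑ i, p i * α i) * (∑ i, p i * β i) := by
        have e1 : ∀ i, Real.sqrt (p i * α i) ^ 2 = p i * α i :=
          fun i => Real.sq_sqrt (mul_nonneg (hp i) (hα i))
        have e2 : ∀ i, Real.sqrt (p i * β i) ^ 2 = p i * β i :=
          fun i => Real.sq_sqrt (mul_nonneg (hp i) (hβ i))
        simp_rw [e1, e2]

/-- Entries of a mixture `Σ_i p_i |ψ_i⟩⟨ψ_i|`. [cite: GuhneSeevinck2010, §1 (“`ρ^bs = Σ_k p_k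
|ψ_k^bs⟩⟨ψ_k^bs|`”)] -/
private theorem mix_apply {ι : Type*} [Fintype ι] (p : ι → ℝ) (ψ : ι → (Fin N → Bool) → ℂ)
    (x y : Fin N → Bool) :
    (∑ i, (p i : ℂ) • vecMulVec (ψ i) (star (ψ i))) x y =
      ∑ i, (p i : ℂ) * (ψ i x * star (ψ i y)) := by
  simp [Matrix.sum_apply, vecMulVec_apply]

/-- Diagonal entries of a mixture: `ρ_I = Σ_i p_i |ψ_i(I)|²`. [cite: GuhneSeevinck2010, §1] -/
private theorem mix_diag_re {ι : Type*} [Fintype ι] (p : ι → ℝ) (ψ : ι → (Fin N → Bool) → ℂ)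
    (x : Fin N → Bool) :
    ((∑ i, (p i : ℂ) • vecMulVec (ψ i) (star (ψ i))) x x).re =
      ∑ i, p i * Complex.normSq (ψ i x) := by
  rw [mix_apply, Complex.re_sum]
  refine Finset.sum_congr rfl fun i _ => ?_
  rw [Complex.star_def, Complex.mul_conj, ← Complex.ofReal_mul, Complex.ofReal_re]

/-- **The `N`-qubit GHZ criterion of Gühne–Seevinck** (Observation 1 for `N = 3`): for every
biseparable `ρ`, `|ρ_{0…0,1…1}| ≤ ½ Σ_{|I|=1}^{N−1} √(ρ_I ρ_Ī)`; violation implies genuine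
`N`-partite entanglement.  Printed proof: the pure-state step plus convexity of `|·|` and
concavity of `√(fg)`. [cite: GuhneSeevinck2010, §2 Observation 1 and §3 (“for `N`-qubit GHZ
states, the criterion reads `𝒪^{|GHZ_N⟩}(ρ) ≤ ½ Σ_{|I|=1}^{N−1} √(ρ_I ρ_Ī)`”)] -/
theorem guhneSeevinck_ghz {ρ : Matrix (Fin N → Bool) (Fin N → Bool) ℂ} (hρ : IsBiseparable ρ) :
    ghzOffDiag ρ ≤ 1 / 2 * gsSum ρ := by
  obtain ⟨ι, _, p, ψ, hp, -, -, hψ, rfl⟩ := hρ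
  -- convexity of `|ρ_{0…0,1…1}|`
  have h1 : ghzOffDiag (∑ i, (p i : ℂ) • vecMulVec (ψ i) (star (ψ i))) ≤
      ∑ i, p i * ghzOffDiag (vecMulVec (ψ i) (star (ψ i))) := by
    rw [ghzOffDiag, mix_apply]
    refine (norm_sum_le _ _).trans (le_of_eq ?_)
    refine Finset.sum_congr rfl fun i _ => ?_
    rw [norm_mul, Complex.norm_of_nonneg (hp i), ghzOffDiag, vecMulVec_apply, Pi.star_apply]
  -- the pure bound inside the mixture
  have h2 : ∑ i, p i * ghzOffDiag (vecMulVec (ψ i) (star (ψ i))) ≤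
      ∑ i, p i * (1 / 2 * gsSum (vecMulVec (ψ i) (star (ψ i)))) :=
    Finset.sum_le_sum fun i _ => mul_le_mul_of_nonneg_left
      (by have := two_mul_ghzOffDiag_le_gsSum_of_isBiseparablePure (hψ i); linarith) (hp i)
  -- exchange the sums
  have h3 : ∑ i, p i * (1 / 2 * gsSum (vecMulVec (ψ i) (star (ψ i)))) =
      1 / 2 * ∑ x ∈ innerLabels N, ∑ i, p i * diagPair (vecMulVec (ψ i) (star (ψ i))) x := by
    have e : ∀ i, p i * (1 / 2 * gsSum (vecMulVec (ψ i) (star (ψ i)))) =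
        ∑ x ∈ innerLabels N, 1 / 2 * (p i * diagPair (vecMulVec (ψ i) (star (ψ i))) x) := by
      intro i
      rw [gsSum, Finset.mul_sum, Finset.mul_sum]
      exact Finset.sum_congr rfl fun x _ => by ring
    simp_rw [e]
    rw [Finset.sum_comm, Finset.mul_sum]
    refine Finset.sum_congr rfl fun x _ => ?_
    rw [Finset.mul_sum]
  -- concavity of each `√(ρ_I ρ_Ī)`
  have h4 : ∀ x, ∑ i, p i * diagPair (vecMulVec (ψ i) (star (ψ i))) x ≤
      diagPair (∑ i, (p i : ℂ) • vecMulVec (ψ i) (star (ψ i))) x := by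
    intro x
    simp_rw [diagPair, pure_diag_re]
    rw [mix_diag_re, mix_diag_re]
    exact sum_mul_sqrt_mul_le p _ _ hp (fun _ => Complex.normSq_nonneg _)
      (fun _ => Complex.normSq_nonneg _)
  have h5 : 1 / 2 * ∑ x ∈ innerLabels N, ∑ i, p i * diagPair (vecMulVec (ψ i) (star (ψ i))) x ≤
      1 / 2 * gsSum (∑ i, (p i : ℂ) • vecMulVec (ψ i) (star (ψ i))) :=
    mul_le_mul_of_nonneg_left (Finset.sum_le_sum fun x _ => h4 x) (by norm_num)
  exact h1.trans (h2.trans (h3.le.trans h5))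

/-- **Violation implies genuine `N`-partite entanglement.** [cite: GuhneSeevinck2010, §2
Observation 1 (“violation implies genuine three-qubit entanglement”) and §3] -/
theorem not_isBiseparable_of_gsSum_lt {ρ : Matrix (Fin N → Bool) (Fin N → Bool) ℂ}
    (h : 1 / 2 * gsSum ρ < ghzOffDiag ρ) : ¬ IsBiseparable ρ :=
  fun hρ => absurd h (not_lt.2 (guhneSeevinck_ghz hρ))

/-! ## In the lane's vocabulary: the coherence `C = |ρ_{0…0,1…1}| + |ρ_{1…1,0…0}|` -/

/-- A biseparable `ρ` (a mixture of projectors) is Hermitian at the GHZ corner: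
`|ρ_{1…1,0…0}| = |ρ_{0…0,1…1}|`. [cite: GuhneSeevinck2010, §1] -/
theorem norm_corner_symm_of_isBiseparable {ρ : Matrix (Fin N → Bool) (Fin N → Bool) ℂ}
    (hρ : IsBiseparable ρ) :
    ‖ρ (constLabel N true) (constLabel N false)‖ = ‖ρ (constLabel N false) (constLabel N true)‖ := by
  obtain ⟨ι, _, p, ψ, -, -, -, -, rfl⟩ := hρ
  rw [mix_apply, mix_apply, ← norm_star, star_sum]
  congr 1
  refine Finset.sum_congr rfl fun i _ => ?_
  rw [star_mul', star_mul', star_star, Complex.star_def, Complex.conj_ofReal, mul_comm (ψ i _)]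

/-- **The criterion with the coherence `C`** of `GHZFidelityWitness.lean` / [MonzEtAl2011]: for
every biseparable `ρ`, `C(ρ) = |ρ_{0…0,1…1}| + |ρ_{1…1,0…0}| ≤ Σ_{0<|I|<N} √(ρ_I ρ_Ī)`.
[cite: GuhneSeevinck2010, §3; MonzEtAl2011, p. 3] -/
theorem coherence_le_gsSum {ρ : Matrix (Fin N → Bool) (Fin N → Bool) ℂ} (hρ : IsBiseparable ρ) :
    coherence ρ ≤ gsSum ρ := by
  have h := guhneSeevinck_ghz hρ
  rw [coherence, norm_corner_symm_of_isBiseparable hρ]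
  rw [ghzOffDiag] at h
  linarith

/-- `C(ρ) > Σ_{0<|I|<N} √(ρ_I ρ_Ī) ⟹ ρ` is genuinely `N`-partite entangled — the form in which a
GHZ experiment reporting populations and the coherence `C` applies the criterion.
[cite: GuhneSeevinck2010, §3; MonzEtAl2011, p. 3] -/
theorem not_isBiseparable_of_gsSum_lt_coherence {ρ : Matrix (Fin N → Bool) (Fin N → Bool) ℂ}
    (h : gsSum ρ < coherence ρ) : ¬ IsBiseparable ρ :=
  fun hρ => absurd h (not_lt.2 (coherence_le_gsSum hρ))

/-! ## Coarse-grained right-hand side (collective readout) -/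

/-- Diagonal entries of a biseparable `ρ` are non-negative: `ρ_I = Σ_i p_i |ψ_i(I)|² ≥ 0`.
[cite: GuhneSeevinck2010, §1] -/
theorem diag_re_nonneg_of_isBiseparable {ρ : Matrix (Fin N → Bool) (Fin N → Bool) ℂ}
    (hρ : IsBiseparable ρ) (x : Fin N → Bool) : 0 ≤ (ρ x x).re := by
  obtain ⟨ι, _, p, ψ, hp, -, -, -, rfl⟩ := hρ
  rw [mix_diag_re]
  exact Finset.sum_nonneg fun i _ => mul_nonneg (hp i) (Complex.normSq_nonneg _)

/-- **Grouping the right-hand side** (Cauchy–Schwarz once more): for any set `S` of labels and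
any `ρ` with non-negative diagonal, `Σ_{I∈S} √(ρ_I ρ_Ī) ≤ √((Σ_{I∈S} ρ_I)·(Σ_{I∈S} ρ_Ī))`.  (A
proved coarse-graining of the printed right-hand side; the source states the criterion with the
individual `ρ_I`.) [cite: GuhneSeevinck2010, §3 (the `N`-qubit GHZ criterion)] -/
theorem sum_diagPair_le (ρ : Matrix (Fin N → Bool) (Fin N → Bool) ℂ) (S : Finset (Fin N → Bool))
    (hρ : ∀ x, 0 ≤ (ρ x x).re) :
    ∑ x ∈ S, diagPair ρ x ≤
      Real.sqrt ((∑ x ∈ S, (ρ x x).re) * (∑ x ∈ S, (ρ (flip x) (flip x)).re)) := by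
  have h := sum_mul_sqrt_mul_le (ι := {x // x ∈ S}) (fun _ => 1) (fun x => (ρ x x).re)
    (fun x => (ρ (flip x) (flip x)).re) (fun _ => zero_le_one) (fun x => hρ x) fun x => hρ (flip x)
  simp only [one_mul] at h
  rw [← Finset.sum_coe_sort S, ← Finset.sum_coe_sort S (fun x => (ρ x x).re),
    ← Finset.sum_coe_sort S (fun x => (ρ (flip x) (flip x)).re)]
  exact h

/-- **The criterion for a coarse-grained readout.**  Group the inner labels by any label
statistic `w` (e.g. the number of excitations `|I|`, with `T = {1, …, N−1}`; then the two inner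
sums below are the excitation-number populations `P_k` and `P_{N−k}` of a collective fluorescence
readout): for every biseparable `ρ`,
`C(ρ) ≤ Σ_{k∈T} √((Σ_{0<|I|<N, w(I)=k} ρ_I)·(Σ_{0<|I|<N, w(I)=k} ρ_Ī))`, so a coherence exceeding the
right-hand side certifies genuine `N`-partite entanglement without resolving individual `ρ_I`.
[cite: GuhneSeevinck2010, §3; MonzEtAl2011, p. 3 (“The diagonal elements of the density matrix
`ρ` are directly measured by fluorescence detection”)] -/
theorem coherence_le_sum_fiber_sqrt {ρ : Matrix (Fin N → Bool) (Fin N → Bool) ℂ}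
    (hρ : IsBiseparable ρ) {κ : Type*} [DecidableEq κ] (w : (Fin N → Bool) → κ) (T : Finset κ)
    (hT : ∀ x ∈ innerLabels N, w x ∈ T) :
    coherence ρ ≤ ∑ k ∈ T,
      Real.sqrt ((∑ x ∈ (innerLabels N).filter (fun x => w x = k), (ρ x x).re) *
        (∑ x ∈ (innerLabels N).filter (fun x => w x = k), (ρ (flip x) (flip x)).re)) := by
  have hd := diag_re_nonneg_of_isBiseparable hρ
  calc coherence ρ ≤ gsSum ρ := coherence_le_gsSum hρ
    _ = ∑ k ∈ T, ∑ x ∈ (innerLabels N).filter (fun x => w x = k), diagPair ρ x :=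
        (Finset.sum_fiberwise_of_maps_to hT _).symm
    _ ≤ _ := Finset.sum_le_sum fun k _ => sum_diagPair_le ρ _ hd

/-! ## “Maximally violated by the GHZ state” -/

/-- `|GHZ_N⟩` vanishes on the inner labels. [cite: GuhneSeevinck2010, §2 (after Observation 1)] -/
theorem ghzN_apply_of_mem_innerLabels {x : Fin N → Bool} (hx : x ∈ innerLabels N) :
    ghzN N x = 0 := by
  rw [mem_innerLabels] at hx
  rw [ghzN, Pi.smul_apply, Pi.add_apply, ket_of_ne hx.1, ket_of_ne hx.2, add_zero, smul_zero]

/-- For `|GHZ_N⟩⟨GHZ_N|` the right-hand side vanishes: `Σ_{0<|I|<N} √(ρ_I ρ_Ī) = 0`.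
[cite: GuhneSeevinck2010, §2 (“Eq. (1) is maximally violated by the GHZ state”)] -/
theorem gsSum_ghzN : gsSum (vecMulVec (ghzN N) (star (ghzN N))) = 0 := by
  refine Finset.sum_eq_zero fun x hx => ?_
  rw [diagPair_pure, ghzN_apply_of_mem_innerLabels hx, norm_zero, zero_mul]

/-- For `|GHZ_N⟩⟨GHZ_N|` the left-hand side is `|ρ_{0…0,1…1}| = 1/2` (`N ≥ 1`).
[cite: GuhneSeevinck2010, §2 (“Eq. (1) is maximally violated by the GHZ state”)] -/
theorem ghzOffDiag_ghzN [NeZero N] : ghzOffDiag (vecMulVec (ghzN N) (star (ghzN N))) = 1 / 2 := by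
  rw [ghzOffDiag_pure]
  have h0 : ghzN N (constLabel N false) = CHSHOpt.invSqrtTwo := by
    rw [ghzN, Pi.smul_apply, Pi.add_apply, ket_self, ket_of_ne constLabel_false_ne_true, add_zero,
      smul_eq_mul, mul_one]
  have h1 : ghzN N (constLabel N true) = CHSHOpt.invSqrtTwo := by
    rw [ghzN, Pi.smul_apply, Pi.add_apply, ket_self, ket_of_ne (Ne.symm constLabel_false_ne_true),
      zero_add, smul_eq_mul, mul_one]
  have hnn : 0 ≤ CHSHOpt.invSqrtTwo := by rw [CHSHOpt.invSqrtTwo]; positivity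
  rw [h0, h1, Complex.norm_real, Real.norm_of_nonneg hnn, CHSHOpt.invSqrtTwo_mul_self]

/-- `|GHZ_N⟩⟨GHZ_N|` violates the criterion (`1/2 > 0`), hence is genuinely `N`-partite entangled
(`N ≥ 1`). [cite: GuhneSeevinck2010, §2 (“Eq. (1) is maximally violated by the GHZ state”)] -/
theorem not_isBiseparable_ghzN [NeZero N] :
    ¬ IsBiseparable (vecMulVec (ghzN N) (star (ghzN N))) :=
  not_isBiseparable_of_gsSum_lt (by rw [gsSum_ghzN, ghzOffDiag_ghzN]; norm_num)

end GuhneSeevinck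

end Literature.InformationTheory.Entanglement
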